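import Literature.MathematicalPhysics.QuantumManyBody.BoseGasCatStates
import HarnessLib

/-!
# No super-gap MODE-FREE window criterion for ground-state BEC, Dirichlet box or torus

`Literature/Barriers/AtomisticToContinuum` — companion of `KineticGapLengthScalesNarrow.lean`
(Galilei boosts: windows `> 4π²M²N/L²` certify at most `n₀ ≤ N/(M+1)` on the torus) and
`KineticGapLengthScalesThermodynamicWindow.lean` (hence no super-gap windowed form of the
periodic-BEC hypothesis), filed by the crux disprover of `PeriodicToDirichlet`
(stmt-AtomisticToContinuum-9483, gen 2), read along the thermodynamic box `L_N = (N/ρ)^{1/3}` from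
the cat states of `BoseGasCatStates.lean` (`exists_fragmented_trialState`: energy
`≤ C_cat m² N/L²`, `λ_max ≤ N/m³`, free gas, Dirichlet; periodised: `n₀ ≤ λ_max ≤ N/m³`):

* `dirichlet_modeFree_window_forces_c_nonpos` — in the DIRICHLET box, a criterion
  "`energy ≤ E₀^D + w_N ⇒ λ_max(γ_Ψ) ≥ cN` for all trial states" whose window eventually contains
  `C_cat M²` gaps per particle for every `M` forces `c ≤ 0`; `eventually_catWindow_le` — every real
  window `g_N` with `g_N/L_N → ∞` is such; hence `dirichlet_modeFree_macroscopicWindow_forces_c_nonpos`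
  (`κN`) and `dirichlet_modeFree_surfaceWindow_forces_c_nonpos` (`κL_N²`, the interacting wall order);
* `not_dirichletBEC_modeFree_window` (+ `_macroscopicWindow`, `_surfaceWindow`) — so NO windowed
  reading of the conjunct `BoseEinsteinCondensation` (`λ_max`, Dirichlet) with a super-gap window is
  true, already at `v = 0`;
* `periodic_modeFree_window_forces_c_nonpos`, `not_periodicBEC_modeFree_window` — the same on the
  torus for the mode-free `λ_max` of the cell-truncated state (replacing `n₀` by `λ_max` rescues no
  windowed reading of the antecedent `PeriodicBEC` of stmt-0827/9483).

Why it is recorded: the conjunct is a `δ → 0` statement (`condensateNumber`), but every proof of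
"periodic BEC ⇒ Dirichlet BEC" that touches Dirichlet states through their ENERGY must certify
`λ_max ≥ cN` in some window above `E₀^D`; this file pins that window to `O(N/L_N²)` on the
Dirichlet side (mode-free), `BoseGasDirichletWall` shows the periodic reference energy lies at
least that far below, and for `v ≠ 0` the wall is of surface order `≫ N/L_N²`. Theorems only;
`[folklore]`.

## References

* [LSSY2005] E. H. Lieb, R. Seiringer, J. P. Solovej, J. Yngvason, *The Mathematics of the Bose Gas
  and its Condensation* (2005), §1.2 and Ch. 5 §5.2.
* The barrier audit `KineticGapLengthScalesNarrow.lean` (this directory), scope caveats (b)–(c).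
-/

noncomputable section

namespace Literature.Barriers.AtomisticToContinuum.BoseGas

open Literature.MathematicalPhysics.QuantumManyBody.BoseGas
open _root_.MeasureTheory _root_.Filter _root_.Topology
open scoped ENNReal NNReal

/-! ### Along the thermodynamic box: no super-gap MODE-FREE window criterion (Dirichlet) -/

variable {ρ : ℝ}

/-- A real window `g_N` with `g_N / L_N → ∞` eventually contains `C_cat M²` gaps per particle,
for every `M`. [folklore] -/
theorem eventually_catWindow_le (hρ : 0 < ρ) (M : ℕ) {g : ℕ → ℝ}
    (hg : Tendsto (fun N : ℕ => g N / sideLength ρ N) atTop atTop) :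
    ∀ᶠ N : ℕ in atTop, ENNReal.ofReal (catEnergyConst * M ^ 2 * N / sideLength ρ N ^ 2) ≤
      ENNReal.ofReal (g N) := by
  filter_upwards [eventually_gt_atTop 0,
    hg.eventually_ge_atTop (catEnergyConst * M ^ 2 * ρ)] with N hN hgN
  have hL : 0 < sideLength ρ N := sideLength_pos_of_pos hρ hN
  have h3 := div_sideLength_pow_three hρ hN
  rw [div_eq_iff (by positivity)] at h3
  refine ENNReal.ofReal_le_ofReal ?_
  rw [le_div_iff₀ hL] at hgN
  calc catEnergyConst * M ^ 2 * N / sideLength ρ N ^ 2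
      = catEnergyConst * M ^ 2 * ρ * sideLength ρ N := by
        rw [h3]; field_simp
    _ ≤ g N := hgN

/-- **No super-gap MODE-FREE window criterion in the Dirichlet box** (free gas, along
`L_N = (N/ρ)^{1/3}`): if `λ_max(γ_Ψ) ≥ cN` held for every Dirichlet trial state within a window
`w_N` of `E₀^D`, and `w_N` eventually contains `C_cat M²` gaps per particle for every `M`, then
`c ≤ 0`. (The mode-free, Dirichlet counterpart of the Galilei-boost obstruction
`window_criterion_forces_c_nonpos` for `n₀` on the torus.) [folklore] -/
theorem dirichlet_modeFree_window_forces_c_nonpos (hρ : 0 < ρ) {c : ℝ} {w : ℕ → ℝ≥0∞}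
    (hw : ∀ M : ℕ, ∀ᶠ N : ℕ in atTop,
      ENNReal.ofReal (catEnergyConst * M ^ 2 * N / sideLength ρ N ^ 2) ≤ w N)
    (hcrit : ∀ᶠ N : ℕ in atTop, ∀ Ψ : TrialState N (sideLength ρ N),
      energy 0 Ψ ≤ groundStateEnergy 0 N (sideLength ρ N) + w N →
        ENNReal.ofReal (c * N) ≤ maxOccupation N Ψ.ψ) :
    c ≤ 0 := by
  by_contra hc
  push Not at hc
  obtain ⟨M, hM⟩ := exists_nat_gt (1 / c)
  have hM0 : 0 < M := by
    have : (0 : ℝ) < M := lt_trans (by positivity) hM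
    exact_mod_cast this
  obtain ⟨N, hN, hwN, hcN⟩ := ((eventually_ge_atTop 2).and ((hw M).and hcrit)).exists
  have hL : 0 < sideLength ρ N := sideLength_pos_of_pos hρ (by omega)
  have hle := dirichlet_window_fraction_le hM0 hN hL hwN hcN
  have hM1 : (1 : ℝ) ≤ M := by exact_mod_cast hM0
  have hMc : 1 / (M : ℝ) < c := by
    rw [div_lt_iff₀ (by positivity)]; rw [div_lt_iff₀ hc] at hM; linarith
  have : 1 / (M : ℝ) ^ 3 ≤ 1 / (M : ℝ) :=
    div_le_div_of_nonneg_left zero_le_one (by positivity) (le_self_pow₀ hM1 three_ne_zero)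
  linarith

/-- **Macroscopic mode-free windows are out** (Dirichlet, free gas): window `κN`, any `κ > 0`.
[folklore] -/
theorem dirichlet_modeFree_macroscopicWindow_forces_c_nonpos (hρ : 0 < ρ) {κ : ℝ} (hκ : 0 < κ)
    {c : ℝ} (hcrit : ∀ᶠ N : ℕ in atTop, ∀ Ψ : TrialState N (sideLength ρ N),
      energy 0 Ψ ≤ groundStateEnergy 0 N (sideLength ρ N) + ENNReal.ofReal (κ * N) →
        ENNReal.ofReal (c * N) ≤ maxOccupation N Ψ.ψ) :
    c ≤ 0 := by
  refine dirichlet_modeFree_window_forces_c_nonpos hρ (w := fun N => ENNReal.ofReal (κ * N))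
    (fun M => eventually_catWindow_le hρ M ?_) hcrit
  have h2 : Tendsto (fun N : ℕ => κ * ρ * sideLength ρ N ^ 2) atTop atTop :=
    ((tendsto_pow_atTop two_ne_zero).comp (tendsto_sideLength_atTop hρ)).const_mul_atTop
      (by positivity)
  refine (tendsto_congr' ?_).mpr h2
  filter_upwards [eventually_gt_atTop 0] with N hN
  have hL : 0 < sideLength ρ N := sideLength_pos_of_pos hρ hN
  have h3 := div_sideLength_pow_three hρ hN
  rw [div_eq_iff (by positivity)] at h3
  rw [h3]
  field_simp

/-- **Surface-order mode-free windows are out too** (Dirichlet, free gas): window `κ L_N²`, any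
`κ > 0` — the order of the interacting Dirichlet wall. [folklore] -/
theorem dirichlet_modeFree_surfaceWindow_forces_c_nonpos (hρ : 0 < ρ) {κ : ℝ} (hκ : 0 < κ)
    {c : ℝ} (hcrit : ∀ᶠ N : ℕ in atTop, ∀ Ψ : TrialState N (sideLength ρ N),
      energy 0 Ψ ≤ groundStateEnergy 0 N (sideLength ρ N) +
          ENNReal.ofReal (κ * sideLength ρ N ^ 2) →
        ENNReal.ofReal (c * N) ≤ maxOccupation N Ψ.ψ) :
    c ≤ 0 := by
  refine dirichlet_modeFree_window_forces_c_nonpos hρ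
    (w := fun N => ENNReal.ofReal (κ * sideLength ρ N ^ 2))
    (fun M => eventually_catWindow_le hρ M ?_) hcrit
  have h1 : Tendsto (fun N : ℕ => κ * sideLength ρ N) atTop atTop :=
    (tendsto_sideLength_atTop hρ).const_mul_atTop hκ
  refine (tendsto_congr' ?_).mpr h1
  filter_upwards [eventually_gt_atTop 0] with N hN
  have hL : 0 < sideLength ρ N := sideLength_pos_of_pos hρ hN
  field_simp

/-- **The windowed, MODE-FREE form of Dirichlet ground-state BEC is false for every super-gap
window** (witness `v = 0`): there is no reading of the conjunct `BoseEinsteinCondensation` in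
which "`λ_max ≥ cN` for all Dirichlet states within `w_N ≫ N/L_N²` of the ground-state energy".
So on the Dirichlet side, too, only windows of the order of ONE kinetic gap per particle can
certify condensation — exactly the order of the free Dirichlet wall `3π²N/L²`, and far below the
interacting wall. [folklore] -/
theorem not_dirichletBEC_modeFree_window {w : ℝ → ℕ → ℝ≥0∞}
    (hw : ∀ ρ : ℝ, 0 < ρ → ∀ M : ℕ, ∀ᶠ N : ℕ in atTop,
      ENNReal.ofReal (catEnergyConst * M ^ 2 * N / sideLength ρ N ^ 2) ≤ w ρ N) :
    ¬ (∀ v : ℝ → ℝ≥0∞, IsRepulsiveFiniteRange v → ∃ ρ₀ : ℝ, 0 < ρ₀ ∧ ∀ ρ : ℝ, 0 < ρ → ρ < ρ₀ →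
        ∃ c : ℝ, 0 < c ∧ ∀ᶠ N : ℕ in atTop, ∀ Ψ : TrialState N (sideLength ρ N),
          energy v Ψ ≤ groundStateEnergy v N (sideLength ρ N) + w ρ N →
            ENNReal.ofReal (c * N) ≤ maxOccupation N Ψ.ψ) := by
  intro h
  obtain ⟨ρ₀, hρ₀, hρ⟩ := h 0 ⟨measurable_const, 0, fun _ _ => rfl⟩
  obtain ⟨c, hc, hcrit⟩ := hρ (ρ₀ / 2) (by positivity) (by linarith)
  exact (not_le.2 hc)
    (dirichlet_modeFree_window_forces_c_nonpos (by positivity) (hw _ (by positivity)) hcrit)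

/-- In particular the macroscopic-window (`κN`) mode-free Dirichlet criterion is false.
[folklore] -/
theorem not_dirichletBEC_modeFree_macroscopicWindow {κ : ℝ} (hκ : 0 < κ) :
    ¬ (∀ v : ℝ → ℝ≥0∞, IsRepulsiveFiniteRange v → ∃ ρ₀ : ℝ, 0 < ρ₀ ∧ ∀ ρ : ℝ, 0 < ρ → ρ < ρ₀ →
        ∃ c : ℝ, 0 < c ∧ ∀ᶠ N : ℕ in atTop, ∀ Ψ : TrialState N (sideLength ρ N),
          energy v Ψ ≤ groundStateEnergy v N (sideLength ρ N) + ENNReal.ofReal (κ * N) →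
            ENNReal.ofReal (c * N) ≤ maxOccupation N Ψ.ψ) := by
  intro h
  obtain ⟨ρ₀, hρ₀, hρ⟩ := h 0 ⟨measurable_const, 0, fun _ _ => rfl⟩
  obtain ⟨c, hc, hcrit⟩ := hρ (ρ₀ / 2) (by positivity) (by linarith)
  exact (not_le.2 hc)
    (dirichlet_modeFree_macroscopicWindow_forces_c_nonpos (by positivity) hκ hcrit)

/-- … and the surface-window (`κL_N²`) mode-free Dirichlet criterion is false. [folklore] -/
theorem not_dirichletBEC_modeFree_surfaceWindow {κ : ℝ} (hκ : 0 < κ) :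
    ¬ (∀ v : ℝ → ℝ≥0∞, IsRepulsiveFiniteRange v → ∃ ρ₀ : ℝ, 0 < ρ₀ ∧ ∀ ρ : ℝ, 0 < ρ → ρ < ρ₀ →
        ∃ c : ℝ, 0 < c ∧ ∀ᶠ N : ℕ in atTop, ∀ Ψ : TrialState N (sideLength ρ N),
          energy v Ψ ≤ groundStateEnergy v N (sideLength ρ N) +
              ENNReal.ofReal (κ * sideLength ρ N ^ 2) →
            ENNReal.ofReal (c * N) ≤ maxOccupation N Ψ.ψ) := by
  intro h
  obtain ⟨ρ₀, hρ₀, hρ⟩ := h 0 ⟨measurable_const, 0, fun _ _ => rfl⟩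
  obtain ⟨c, hc, hcrit⟩ := hρ (ρ₀ / 2) (by positivity) (by linarith)
  exact (not_le.2 hc)
    (dirichlet_modeFree_surfaceWindow_forces_c_nonpos (by positivity) hκ hcrit)



/-! ### The torus, mode-free -/

/-- **No super-gap mode-free window criterion on the torus** (free gas, thermodynamic box).
[folklore] -/
theorem periodic_modeFree_window_forces_c_nonpos (hρ : 0 < ρ) {c : ℝ} {w : ℕ → ℝ≥0∞}
    (hw : ∀ M : ℕ, ∀ᶠ N : ℕ in atTop,
      ENNReal.ofReal (catEnergyConst * M ^ 2 * N / sideLength ρ N ^ 2) ≤ w N)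
    (hcrit : ∀ᶠ N : ℕ in atTop, ∀ Φ : PeriodicTrialState N (sideLength ρ N),
      periodicEnergy 0 Φ ≤ periodicGroundStateEnergy 0 N (sideLength ρ N) + w N →
        ENNReal.ofReal (c * N) ≤ maxOccupation N ((cellN N (sideLength ρ N)).indicator Φ.ψ)) :
    c ≤ 0 := by
  by_contra hc
  push Not at hc
  obtain ⟨M, hM⟩ := exists_nat_gt (1 / c)
  have hM0 : 0 < M := by
    have : (0 : ℝ) < M := lt_trans (by positivity) hM
    exact_mod_cast this
  obtain ⟨N, hN, hwN, hcN⟩ := ((eventually_ge_atTop 2).and ((hw M).and hcrit)).exists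
  have hL : 0 < sideLength ρ N := sideLength_pos_of_pos hρ (by omega)
  have hle := periodic_modeFree_window_fraction_le hM0 hN hL hwN hcN
  have hM1 : (1 : ℝ) ≤ M := by exact_mod_cast hM0
  have hMc : 1 / (M : ℝ) < c := by
    rw [div_lt_iff₀ (by positivity)]; rw [div_lt_iff₀ hc] at hM; linarith
  have : 1 / (M : ℝ) ^ 3 ≤ 1 / (M : ℝ) :=
    div_le_div_of_nonneg_left zero_le_one (by positivity) (le_self_pow₀ hM1 three_ne_zero)
  linarith

/-- **The windowed MODE-FREE form of periodic BEC is false for every super-gap window** (witness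
`v = 0`): replacing `n₀` by `λ_max` does not rescue any windowed reading of the antecedent
`PeriodicBEC` of `PeriodicToDirichlet` / stmt-0827. [folklore] -/
theorem not_periodicBEC_modeFree_window {w : ℝ → ℕ → ℝ≥0∞}
    (hw : ∀ ρ : ℝ, 0 < ρ → ∀ M : ℕ, ∀ᶠ N : ℕ in atTop,
      ENNReal.ofReal (catEnergyConst * M ^ 2 * N / sideLength ρ N ^ 2) ≤ w ρ N) :
    ¬ (∀ v : ℝ → ℝ≥0∞, IsRepulsiveFiniteRange v → ∃ ρ₀ : ℝ, 0 < ρ₀ ∧ ∀ ρ : ℝ, 0 < ρ → ρ < ρ₀ →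
        ∃ c : ℝ, 0 < c ∧ ∀ᶠ N : ℕ in atTop, ∀ Φ : PeriodicTrialState N (sideLength ρ N),
          periodicEnergy v Φ ≤ periodicGroundStateEnergy v N (sideLength ρ N) + w ρ N →
            ENNReal.ofReal (c * N) ≤ maxOccupation N ((cellN N (sideLength ρ N)).indicator Φ.ψ)) := by
  intro h
  obtain ⟨ρ₀, hρ₀, hρ⟩ := h 0 ⟨measurable_const, 0, fun _ _ => rfl⟩
  obtain ⟨c, hc, hcrit⟩ := hρ (ρ₀ / 2) (by positivity) (by linarith)
  exact (not_le.2 hc)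
    (periodic_modeFree_window_forces_c_nonpos (by positivity) (hw _ (by positivity)) hcrit)

end Literature.Barriers.AtomisticToContinuum.BoseGas

end
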